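import Mathlib.Analysis.SpecialFunctions.Complex.Log
import Mathlib.Analysis.Calculus.IteratedDeriv.Defs
import Mathlib.Order.LiminfLimsup
import Literature.Probability.LatticeModels.IsingThermodynamics
import HarnessLib

/-!
# Thermodynamic limit of the first Lee–Yang zero (Jiang–Newman 2023)

Topic `Probability/LatticeModels`. NAMED FACT (D-0014) requested by route
`CriticalPhenomena/Ising3DConformalLimit/LeeYangGap` (items `NewmanFirstZeroBound`,
`MonotonicityTransfer`, layer-2 child `GapReachesEdge`).

## Source (READ: arXiv:2210.03602 = CPAM 77 (2024) 1224–1234, §1–§2 in full)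

J. Jiang, C. M. Newman, *Thermodynamic limit of the first Lee–Yang zero* [JiangNewman2023]. Setting
(§1, eqs. (1.1)–(1.5)): nearest-neighbour ferromagnetic Ising model on a finite `Λ ⊂ ℤ^d`, FREE
boundary condition, inverse temperature `β ≥ 0`, and — NOTE THE NORMALISATION — field `h`
entering the Gibbs weight as `exp[β ∑_{uv} σ_u σ_v + h ∑_u σ_u]` (`h` is NOT multiplied by `β`;
in the Friedli–Velenik convention of the tree's `isingPartitionFunction` this `h` is `βh`, see
`partitionFunction_ofReal_mul`). `Z_{Λ,β,h}` is the partition function, a function of `h ∈ ℂ`;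
by Lee–Yang its zeros are `± i α_j(Λ, β)`, `0 < α₁ ≤ α₂ ≤ …`; `f_{Λ,β}(h) = ln Z_{Λ,β,h}/|Λ|`;
`f_β(h) = lim_n f_{B_n,β}(h)` (`h ∈ ℝ`, `B_n = [-n, n]^d`, exists by Friedli–Velenik Thm. 3.6);
`β_c(d)` the critical inverse temperature (`β_c(1) = ∞`, `0 < β_c(d) < ∞` for `d ≥ 2`).

* **Theorem 1.** For `β ≥ 0` and finite `Λ_n ↑ ℤ^d`, `α₁(Λ_n, β)` DECREASES to
  `α₁(ℤ^d, β) ∈ [0, ∞)`, the radius of the largest disc centred at `0` on which `f_β` is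
  analytic; moreover `α₁(ℤ^d, β) > 0` iff `β ∈ [0, β_c(d))`.
* **Prop. 1.** `u_k(M_{B_n,β,0})/|B_n| → b_k(β) := ∑_{v_1,…,v_{k-1}} u_k^{ℤ^d,β,0}(σ_0, σ_{v_1}, …)`
  (cumulants of the total magnetisation `M_Λ = ∑_{v ∈ Λ} σ_v`, `u_k(M) = dᵏ ln Z/dhᵏ`, eq. (2.3)).
* **Prop. 2.** `lim_n α₁(B_n, β) = r(β)`, `r(β) := 1/limsup_k [|b_k(β)|/k!]^{1/k}` for `β < β_c(d)`
  and `r(β) := 0` for `β ≥ β_c(d)`; on the way (eq. (2.15)–(2.17)):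
  `u_{2k-1}(M_Λ) = 0`, `u_{2k}(M_Λ) = (-1)^{k-1} ((2k)!/k) ∑_j α_j(Λ,β)^{-2k}` and
  `∑_j α_j^{-2k} ≤ 4|Λ| α₁^{-2k}` (`Z_{Λ,β,ih}` has period `2π` in `h` and exactly `2|Λ|` zeros per
  period; Hadamard factorisation, [HouJiangNewman2023, Lemma 1]).
* **Prop. 3** (`β < β_c(d)`; uses [Ott2019, Cor. 1.4], [Lebowitz1972] and Aizenman–Barsky–Fernández
  sharpness): `f_β(h) = f_β(0) + ∑_k b_k(β) hᵏ/k!` for `|h| < r(β)`, `b_k = f_β^{(k)}(0)`, and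
  `r(β) > 0` is the analyticity radius of `f_β` at `0`.
* **Lemma 1.** `f_{β_c(d)}` is not twice differentiable at `0`; for `β ≥ β_c(d)`, `f_β` is not
  analytic in any neighbourhood of `0`.

## What is vendored

Real definitions (namespace `JiangNewman`): the complex-field free-boundary partition function
`partitionFunction d Λ β h` (JN (1.2)), the first zero modulus `firstZero d Λ β` (JN (1.3)), the
finite-volume and limiting free energies `freeEnergyIn`, `freeEnergy` (JN (1.4)–(1.5)), the
cumulants `magnetizationCumulant` (JN (2.2)–(2.3), as `h`-derivatives of `ln Z` at `0`), the
predicate `AnalyticOnDisc d β ρ` ("`f_β` extends holomorphically to `|h| < ρ`"), with proved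
sanity lemmas (normalisation bridge to `isingPartitionFunction`, positivity at real field,
`2πi`-periodicity). ONE named fact, `JiangNewman.FirstZeroLimit`: Theorem 1 for the boxes
`Λ_n = B_n` together with the identifications of Props. 1–3 (limit of the cumulant densities,
`b_k = f_β^{(k)}(0)`, `1/α₁(ℤ^d,β) = limsup [|b_{2k}|/(2k)!]^{1/(2k)}` for `β < β_c`), stated for
`d ≥ 2` (the tree's `criticalBeta 1` is a junk `0`, whereas `β_c(1) = ∞`).

NOT vendored (words only): general exhausting sequences `Λ_n` (they follow from the box case and
the monotonicity in `Λ` of [CamiaJiangNewman2023, Cor. 1], a separate source); the Ursell-sum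
expression of `b_k` (needs infinite-volume joint Ursell functions of spins); the finite-volume
identities (2.15)–(2.17) relating `u_{2k}(M_Λ)` to `∑_j α_j^{-2k}` — these are PROVABLE in the
tree from the proved Lee–Yang theorem (`lee_yang_ising_holds`) and Euler's product for `sin`, and
should be filed as a prover item if wanted (they concern `Z_Λ`, i.e. the full-volume magnetisation
under the finite free measure, not the block spin of `NewmanFirstZeroBound`).

## References

* [JiangNewman2023] J. Jiang, C. M. Newman, CPAM 77 (2024) 1224–1234, doi:10.1002/cpa.22159,
  arXiv:2210.03602 — Thm. 1, Props. 1–3, Lemma 1, eqs. (2.15)–(2.17).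
* [HouJiangNewman2023] Q. Hou, J. Jiang, C. M. Newman, J. Stat. Phys. 190 (2023), Lemma 1.
* [CamiaJiangNewman2023] F. Camia, J. Jiang, C. M. Newman, monotonicity of Ursell functions /
  of the first Lee–Yang zero (Thm. 1, Cor. 1).
* [Ott2019] S. Ott, CMP 377 (2020), Cor. 1.4; [Lebowitz1972]; [AizenmanBarskyFernandez1987];
  [FriedliVelenik2017] Thm. 3.6 (existence of `f_β`), Def. 3.29 (`β_c`).
-/

noncomputable section

open Filter Topology Finset Complex

namespace Literature.Probability.LatticeModels

namespace JiangNewman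

variable (d : ℕ)

/-! ### Definitions -/

/-- Jiang–Newman's partition function in a COMPLEX field, free boundary condition on a finite
`Λ ⊂ ℤ^d`: `Z_{Λ,β,h} = ∑_{σ ∈ {±1}^Λ} exp[β ∑_{uv ∈ Λ} σ_u σ_v + h ∑_{u ∈ Λ} σ_u]`, the first
sum over nearest-neighbour edges with both ends in `Λ` (JN eq. (1.2)). Normalisation: `h` is not
multiplied by `β` (it is `βh` in the Friedli–Velenik convention of `isingPartitionFunction`, see
`partitionFunction_ofReal_mul`). Configurations are enumerated as `τ : Λ → ℤˣ` glued with the free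
boundary condition, exactly as in `isingPartitionFunction`. [cite: JiangNewman2023, §1 eq. (1.2)] -/
def partitionFunction (Λ : Finset (Site d)) (β : ℝ) (h : ℂ) : ℂ :=
  ∑ τ : Λ → ℤˣ,
    Complex.exp (((β * ∑ e ∈ edgesIn (zdGraph d) Λ, bondSpin (glue Λ τ .free) e : ℝ) : ℂ) +
      h * ((∑ x ∈ Λ, spinAt x (glue Λ τ .free) : ℝ) : ℂ))

/-- The modulus `α₁(Λ, β)` of the first Lee–Yang zero: the least `t > 0` with `Z_{Λ,β,it} = 0`
(JN eq. (1.3): all zeros are `± iα_j`, `0 < α₁ ≤ α₂ ≤ …`, by the Lee–Yang theorem — in the tree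
`lee_yang_ising_holds` — and the symmetry `h ↦ -h`). Rendered as an `sInf`; junk value `0` if there
were no zero (there always are: `Z_{Λ,β,ih}` has exactly `2|Λ|` zeros per period `2π`, JN §2).
[cite: JiangNewman2023, §1 eq. (1.3)] -/
def firstZero (Λ : Finset (Site d)) (β : ℝ) : ℝ :=
  sInf {t : ℝ | 0 < t ∧ partitionFunction d Λ β (t * I) = 0}

/-- The finite-volume free energy `f_{Λ,β}(h) = ln Z_{Λ,β,h} / |Λ|` at REAL field (JN eq. (1.4);
"except for a multiplicative constant and a minus sign, this is the free energy … sometimes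
referred to as the pressure"). Junk `0` for `Λ = ∅`. [cite: JiangNewman2023, §1 eq. (1.4)] -/
def freeEnergyIn (Λ : Finset (Site d)) (β h : ℝ) : ℝ :=
  Real.log (partitionFunction d Λ β h).re / (#Λ : ℝ)

/-- The free energy `f_β(h) = lim_n f_{B_n,β}(h)`, `B_n = [-n, n]^d = box d n`, at real field
(JN eq. (1.5); the limit exists, Friedli–Velenik Thm. 3.6). Defined by `limUnder` (junk if the
limit failed to exist). For `β > 0` it is the tree's pressure at field `h/β`.
[cite: JiangNewman2023, §1 eq. (1.5)] -/
def freeEnergy (β h : ℝ) : ℝ :=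
  limUnder atTop fun n : ℕ => freeEnergyIn d (box d n) β h

/-- "`f_β` is analytic on the disc of radius `ρ` about `h = 0`": some function holomorphic on
`|h| < ρ` agrees with `f_β` on the real diameter. [cite: JiangNewman2023, Thm. 1 (analyticity radius)] -/
def AnalyticOnDisc (β ρ : ℝ) : Prop :=
  ∃ F : ℂ → ℂ, DifferentiableOn ℂ F (Metric.ball 0 ρ) ∧
    ∀ h : ℝ, |h| < ρ → F h = freeEnergy d β h

/-- The cumulants of the total magnetisation `M_Λ = ∑_{v ∈ Λ} σ_v` at zero field,
`u_k(M_{Λ,β,0}) = dᵏ/dtᵏ ln ⟨e^{tM}⟩|_{t=0} = dᵏ ln Z_{Λ,β,h}/dhᵏ|_{h=0}` (JN eqs. (2.2)–(2.3)),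
rendered as the `k`-th derivative at `0` of the real function `h ↦ ln Z_{Λ,β,h}`.
[cite: JiangNewman2023, §2 eqs. (2.2)–(2.3)] -/
def magnetizationCumulant (Λ : Finset (Site d)) (β : ℝ) (k : ℕ) : ℝ :=
  iteratedDeriv k (fun h : ℝ => Real.log (partitionFunction d Λ β h).re) 0

/-! ### Sanity lemmas -/

/-- **Normalisation bridge.** At the real field `βh`, Jiang–Newman's partition function is the
tree's free-boundary partition function of Friedli–Velenik at field `h`:
`Z^{JN}_{Λ,β}(βh) = Z^{FV,∅}_{Λ;β,h}` (both are `∑_σ exp[β ∑ σσ + βh ∑ σ]`). [folklore] -/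
theorem partitionFunction_ofReal_mul (Λ : Finset (Site d)) (β h : ℝ) :
    partitionFunction d Λ β ((β * h : ℝ) : ℂ) =
      (isingPartitionFunction (zdGraph d) Λ β h .free : ℂ) := by
  unfold partitionFunction isingPartitionFunction isingWeight isingHamiltonian
  rw [Complex.ofReal_sum]
  refine Finset.sum_congr rfl fun τ _ => ?_
  rw [Complex.ofReal_exp, interactionEdges_free]
  congr 1
  push_cast
  ring

/-- At a real field the partition function is real and positive. [folklore] -/
theorem partitionFunction_ofReal (Λ : Finset (Site d)) (β h : ℝ) :
    partitionFunction d Λ β (h : ℂ) =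
      ((∑ τ : Λ → ℤˣ, Real.exp (β * ∑ e ∈ edgesIn (zdGraph d) Λ, bondSpin (glue Λ τ .free) e +
        h * ∑ x ∈ Λ, spinAt x (glue Λ τ .free)) : ℝ) : ℂ) := by
  unfold partitionFunction
  rw [Complex.ofReal_sum]
  refine Finset.sum_congr rfl fun τ _ => ?_
  rw [Complex.ofReal_exp]
  push_cast
  ring_nf

/-- Positivity of the real part at real field. [folklore] -/
theorem partitionFunction_ofReal_re_pos (Λ : Finset (Site d)) (β h : ℝ) :
    0 < (partitionFunction d Λ β (h : ℂ)).re := by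
  rw [partitionFunction_ofReal, Complex.ofReal_re]
  exact Finset.sum_pos (fun τ _ => Real.exp_pos _) Finset.univ_nonempty

/-- The total magnetisation `∑_{x ∈ Λ} σ_x` is an integer. [folklore] -/
theorem sum_spinAt_eq_intCast (Λ : Finset (Site d)) (σ : SpinConfig (Site d)) :
    ∑ x ∈ Λ, spinAt x σ = ((∑ x ∈ Λ, ((σ x : ℤˣ) : ℤ) : ℤ) : ℝ) := by
  rw [Int.cast_sum]
  rfl

/-- **Periodicity** `Z_{Λ,β,h + 2πi} = Z_{Λ,β,h}` (the magnetisation is an integer), whence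
`h ↦ Z_{Λ,β,ih}` has period `2π` (JN §2, before eq. (2.16)). [cite: JiangNewman2023, §2 (period 2π of Z_{Λ,β,ih})] -/
theorem partitionFunction_add_two_pi_I (Λ : Finset (Site d)) (β : ℝ) (h : ℂ) :
    partitionFunction d Λ β (h + 2 * Real.pi * I) = partitionFunction d Λ β h := by
  unfold partitionFunction
  refine Finset.sum_congr rfl fun τ _ => ?_
  rw [sum_spinAt_eq_intCast]
  set m : ℤ := ∑ x ∈ Λ, ((glue Λ τ .free x : ℤˣ) : ℤ)
  push_cast
  rw [add_mul, ← add_assoc, Complex.exp_add, mul_comm (2 * (Real.pi : ℂ) * I) (m : ℂ),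
    Complex.exp_int_mul_two_pi_mul_I, mul_one]

/-- `α₁(Λ, β) ≥ 0`. [folklore] -/
theorem firstZero_nonneg (Λ : Finset (Site d)) (β : ℝ) : 0 ≤ firstZero d Λ β :=
  Real.sInf_nonneg fun _ ht => ht.1.le

/-! ### The named fact -/

/-- NAMED FACT — **Jiang–Newman 2023, Theorem 1 (with Propositions 1–3 and Lemma 1), for the boxes
`B_n = [-n, n]^d`.** For `d ≥ 2` and `β ≥ 0`, in Jiang–Newman's normalisation of the field
(`partitionFunction`, `h` = Friedli–Velenik's `βh`):
(i) `n ↦ α₁(B_n, β)` is non-increasing [Thm. 1, "`α₁(Λ_n,β) ↓`", via CamiaJiangNewman2023 Cor. 1];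
(ii) its limit `a = α₁(ℤ^d, β) ∈ [0, ∞)` is the radius of the largest disc about `0` on which the
free energy `f_β` (which exists as the limit of `f_{B_n,β}`, eq. (1.5), Friedli–Velenik Thm. 3.6 —
clause (0)) is analytic: `f_β` extends holomorphically to `|h| < ρ` for every `0 < ρ ≤ a` and to no
disc `|h| < ρ` with `ρ > a` [Thm. 1; Prop. 3; Lemma 1 for `β ≥ β_c`];
(iii) `a > 0 ↔ β < β_c(d)` [Thm. 1, "Moreover"];
(iv) for `β < β_c(d)`: the cumulant densities `u_k(M_{B_n,β,0})/|B_n|` converge, for every `k`, to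
`b_k(β) = f_β^{(k)}(0)` [Prop. 1 with Prop. 3, eq. (2.21)], and
`1/a = limsup_k [|b_{2k}(β)|/(2k)!]^{1/(2k)}` [Prop. 2, `r(β)`, eq. (2.11); odd `b_k` vanish].
Stated for `2 ≤ d` only (the source covers `d ≥ 1` with `β_c(1) = ∞`; the tree's `criticalBeta 1`
is a junk `0`). Deep inputs of the printed proof: Lee–Yang, CJN monotonicity of Ursell functions,
Lebowitz's derivative bounds, ABF sharpness, Ott's analyticity [Ott2019, Cor. 1.4]. Users take
`(h : JiangNewman.FirstZeroLimit)`. [cite: JiangNewman2023, Thm. 1, Props. 1–3, Lemma 1] -/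
def FirstZeroLimit : Prop :=
  ∀ (d : ℕ), 2 ≤ d → ∀ β : ℝ, 0 ≤ β →
    (∀ h : ℝ, Tendsto (fun n : ℕ => freeEnergyIn d (box d n) β h) atTop (𝓝 (freeEnergy d β h))) ∧
    Antitone (fun n : ℕ => firstZero d (box d n) β) ∧
    ∃ a : ℝ, 0 ≤ a ∧ Tendsto (fun n : ℕ => firstZero d (box d n) β) atTop (𝓝 a) ∧
      (∀ ρ : ℝ, 0 < ρ → ρ ≤ a → AnalyticOnDisc d β ρ) ∧
      (∀ ρ : ℝ, a < ρ → ¬ AnalyticOnDisc d β ρ) ∧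
      (0 < a ↔ β < criticalBeta d) ∧
      (β < criticalBeta d →
        (∀ k : ℕ, Tendsto (fun n : ℕ => magnetizationCumulant d (box d n) β k / (#(box d n) : ℝ))
          atTop (𝓝 (iteratedDeriv k (freeEnergy d β) 0))) ∧
        a⁻¹ = limsup (fun k : ℕ =>
          (|iteratedDeriv (2 * k) (freeEnergy d β) 0| / ((2 * k).factorial : ℝ)) ^ ((1 : ℝ) / (2 * k)))
          atTop)

/-- The zero-free-region reading of (i)–(iii) [JiangNewman2023, Cor. 1]: for `β < β_c(d)` there is
`a > 0` with `α₁(B_n, β) ≥ a` for all `n` (a non-increasing sequence dominates its limit).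
Relies on: hypothesis `h` (the named fact). [cite: JiangNewman2023, Cor. 1] -/
theorem FirstZeroLimit.exists_pos_le_firstZero (h : FirstZeroLimit) {d : ℕ} (hd : 2 ≤ d) {β : ℝ}
    (hβ : 0 ≤ β) (hβc : β < criticalBeta d) :
    ∃ a : ℝ, 0 < a ∧ ∀ n : ℕ, a ≤ firstZero d (box d n) β := by
  obtain ⟨-, hanti, a, -, hlim, -, -, hpos, -⟩ := h d hd β hβ
  exact ⟨a, hpos.mpr hβc, fun n => hanti.le_of_tendsto hlim n⟩

end JiangNewman

end Literature.Probability.LatticeModels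

end
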